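import Mathlib
import HarnessLib
import HarnessLib.Audit
import Summits.Parity.Statement
import Literature.NumberTheory.Sieve.PolynomialCongruences

/-!
Route: CubicKloosterman

CLOSED (retired) 2026-08-15T13:49:32Z by operator:999:1257524 — reason: not-a-thesis: assembly does not conclude the sub-problem Statement — note: D-0027 §2.1 audit (human 2026-08-15: routes that do not decide the summit are removed): the assembly concludes `RootsModPrimesCbrtTwo`, not the sub-problem statement; a NEW conforming route may be opened from the same idea (generated `closes : … → _root_.BatemanHorn`).. The file is kept as the record of this route; refuted decls are indexed as negative knowledge (`ledger negatives`).

# Route CubicKloosterman — roots of X^3=2 (mod N) are Kloosterman fractions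
c^2*inv(b^3-2c^3)/(b^2-ac): log-saving Type-I + Type-II for cubic Weyl sums give CubicRoots r3 for
X^3-2 by GL2 means

SUPPLIER route for the pure cubic f = X³ − 2 (realises idea card cubic-kloosterman-dictionary).
Target = the f = X³−2 slice of
CubicRoots r3 (stmt-Parity-0878 `CubicRootsPrimeModuli`; = Kowalski–Soundararajan Conj. A.2 for
X³−2): for every h ≠ 0,
Σ_{p≤P} Σ_{ν³≡2 (p)} e(hν/p) = o(P/log P), with S_f(h,n) =
`Literature.NumberTheory.Sieve.polyRootWeylSum`. It suffices to show
X = WeylTypeI ∧ WeylTypeII for the sequence n ↦ S_f(h,n): (WeylTypeI) level of distribution N^η in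
the progressions q ∣ n
with a saving (log N)^{-A} for every A (Bombieri–Vinogradov form, max over the cutoff); (WeylTypeII)
ℓ²-normalised bilinear
cancellation Σ_{m~M}Σ_{n~N} α_m β_n S_f(h,mn) ≪ ‖α‖‖β‖(MN)^{1/2}(log x)^{-A} for M, N ≥ x^δ, MN ≤ x.
Vaughan's identity (support
RootWeylSumsVaughan, degree-blind) turns X into the target. The CONTENT is the engine proposed for
both halves: by the cubic Gauss
dictionary (supports GaussDictionaryRoot/Fraction) the root of X³ ≡ 2 modulo a norm N(a+b∛2+c∛4) is
ν/N ≡ c²·\overline{(b³−2c³)}/(b²−ac)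
+ O(1/N) (mod 1), so for fixed (b,c) the a-sum is an incomplete Kloosterman sum of length N^{1/3} to
the modulus b³−2c³ ≍ N — crux
ShortKloostermanCubicModuli is WeylTypeI's model case in this normal form.
Lean: `(∀ h : ℤ, h ≠ 0 → ∀ A : ℝ, 0 < A → ∃ η : ℝ, 0 < η ∧ ∃ C : ℝ, ∀ N : ℕ, 2 ≤ N → ∀ y : ℕ → ℕ, (∀
q, y q ≤ N) → ∑ q ∈ Finset.Icc 1 ⌊(N : ℝ) ^ η⌋₊, ‖∑ n ∈ (Finset.Icc 1 (y q)).filter (fun n : ℕ => q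
∣ n), Literature.NumberTheory.Sieve.polyRootWeylSum (Polynomial.X ^ 3 - Polynomial.C 2) n h‖ ≤ C *
(N : ℝ) / Real.log N ^ A) ∧ (∀ h : ℤ, h ≠ 0 → ∀ δ : ℝ, 0 < δ → ∀ A : ℝ, 0 < A → ∃ C : ℝ, ∀ x M N :
ℕ, 2 ≤ x → (x : ℝ) ^ δ ≤ M → (x : ℝ) ^ δ ≤ N → (M : ℝ) * N ≤ x → ∀ α β : ℕ → ℂ, ‖∑ m ∈ Finset.Ioc M
(2 * M), ∑ n ∈ Finset.Ioc N (2 * N), α m * β n * Literature.NumberTheory.Sieve.polyRootWeylSum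
(Polynomial.X ^ 3 - Polynomial.C 2) (m * n) h‖ ≤ C * Real.sqrt (∑ m ∈ Finset.Ioc M (2 * M), ‖α m‖ ^
2) * Real.sqrt (∑ n ∈ Finset.Ioc N (2 * N), ‖β n‖ ^ 2) * Real.sqrt ((M : ℝ) * N) / Real.log x ^ A)`

## Assembly
Pure logic plus two facts about the polynomial: apply RootWeylSumsVaughan to f = X³ − C 2 (natDegree
= 3 ≥ 2 by
Polynomial.natDegree_X_pow_sub_C; Irreducible by Eisenstein at 2, Mathlib
`Polynomial.irreducible_of_eisenstein_criterion` /
`Polynomial.Monic.irreducible_of_irreducible_map`), feeding it WeylTypeI and WeylTypeII verbatim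
(the two hypotheses of the support
are the two cruxes with f substituted; checked by an `example` in the session Sketch). Downstream
(not part of this route):
RootsModPrimesCbrtTwo is the X³−2 slice of CubicRoots r3, which with r4 feeds that route's
undecomposed 'signed Type-I for A_d(x),
d ∈ [x, x^{2+η}]' step towards CubicMobiusTail → CubicBH → BatemanHorn.

Rationale: WHY THIS LINE. Mechanism: Hooley's 1978 norm-form parametrisation of the roots of ν³ ≡ 2 (re-derived
by Welsh2018CubicCongruenceSpacing = arXiv:1809.05211,
Thm 1: ν/m = (bu−cv)/(b²−ac) + (2c²−ab)/(m(b²−ac)) with Bezout data (u,v,w)) collapses, because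
(c∛2)³ ∈ ℚ, to the closed Kloosterman
fraction c²·\overline{F(b,c)}/(b²−ac), F(b,c) = b³−2c³ (verified: `ring`/`linear_combination` proofs
in the session folder, numerics by the
card's triage); after reciprocity every root statistic of X³−2 over norm moduli is a family of
incomplete Kloosterman sums of length
q^{1/3} to binary-cubic-form moduli q = F(b,c) — Hooley1978CubicPrimeFactor used this for P⁺(n³+2)
conditionally on Hypothesis R*,
HeathBrown2001LargestPrimeFactorCubic / Irving2014LargestPrimeFactorCubic unconditionally but only
with factorable moduli and POWER
savings (Irving p.3: asymptotics for #{n : d ∣ n³+2} only for d ≤ X). The line points this GL₂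
machinery at PRIME MODULI
(CubicRoots r3), where Vaughan's identity needs only LOG-power Type-I savings at level N^η plus
Type-II — the regime of short-sum
technology that is useless for P⁺ (Karatsuba1995, Korolev2016, Bourgain–Garaev arXiv:1211.4184) and
of mean values over the modulus
family. Imported areas: exponential sums / Kloostermania (DeshouillersIwaniec1982,
DukeFriedlanderIwaniec1997 bilinear Kloosterman
fractions), the sieve architecture of DukeFriedlanderIwaniec1995 (deg 2; Harman1997 p.171: α = ε, β
= 1/3−2ε, Type-I level x^{1/2−ε}),
and the arithmetic of ℤ[∛2] (h = 1, unit 1+∛2+∛4; tree infrastructure `HeathBrownCubic*`,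
`normFormZ`). What it does that route
CubicRoots does not: CubicRoots imports SL₃ dynamics on a fixed torus orbit (Welsh 2018 p.4: that
hope 'may have been misplaced' —
root matrices fill a thin set of unipotent cosets); here the pure-cubic collapse keeps everything on
GL₂/Kloosterman objects, and the
route files the Type-II half as its own crux instead of presuming a large sieve supplies it
(Welsh2018 Thm 3 is 2-dimensional and
trivial in 1-D). Negatives index: empty for Parity at filing.

RANKED CRUXES. #0 RootsModPrimesCbrtTwo (target) — for every integer h ≠ 0, Σ_{p ≤ P} Σ_{ν mod p, ν³
≡ 2} e(hν/p) = o(P/log P) (p prime) — the f = X³−2 instance of CubicRoots.CubicRootsPrimeModuli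
(stmt-Parity-0878: natDegree (X³−C 2) = 3, Eisenstein at 2), i.e. Kowalski–Soundararajan Conj. A.2
for X³−2 in Weyl form; Σ_{p≤P} ρ(p) ~ P/log P by the prime ideal theorem for ℚ(∛2). (why it might
fail: open since DFI 1995 (degree 2 only:
Literature.NumberTheory.Sieve.dukeFriedlanderIwaniecToth_quadraticRoots_primeModuli); false only if
the roots of X³≡2 are biased mod p, against Chebotarev/Hecke expectations; refuter numerics on 0878
to P = 10⁶ show square-root cancellation.) [KowalskiSoundararajan2021, DukeFriedlanderIwaniec1995,
Toth2000, Welsh2018CubicCongruenceSpacing, Welsh2022]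
#2 WeylTypeI (crux) — (card item N2, Weyl-sum form) for every h ≠ 0 and A > 0 there are η > 0 and C
with Σ_{q ≤ N^η} max_{y ≤ N} |Σ_{n ≤ y, q ∣ n} S_f(h,n)| ≤ C N/(log N)^A for all N ≥ 2, f = X³−2,
S_f = polyRootWeylSum (the max is rendered by an arbitrary cutoff function y(q) ≤ N). Level N^η
only; any A. q = 1 is Hooley 1964 with A = δ₃ = (3−√3)/6 ≈ 0.21 (PROVED in the tree:
hooley_polyRoots_logPowerSaving_holds); every A > 0.22 is new. [difficulty: XL] (why it might fail:
Print has only (log N)^-0.21 at q=1 (Hooley 1964). Each (b,c)-fibre is a Kloosterman sum of length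
q0^(1/3): pointwise Karatsuba/Korolev bounds save a fixed small log-power (prime q0), so every A
must come from averaging over the thin moduli b^3-2c^3, for which no mean-value theory exists.)
[Hooley1964, Hooley1978CubicPrimeFactor, HeathBrown2001LargestPrimeFactorCubic, Karatsuba1995,
Korolev2016, arXiv:1211.4184, DartygeMartin2019]
#3 WeylTypeII (crux) — for every h ≠ 0, δ > 0, A > 0 there is C such that for x ≥ 2, M, N ≥ x^δ with
MN ≤ x and all complex α, β: |Σ_{M<m≤2M} Σ_{N<n≤2N} α_m β_n S_f(h, mn)| ≤ C ‖α‖₂ ‖β‖₂ (MN)^{1/2}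
(log x)^{-A} (f = X³−2). By twisted multiplicativity (tree: polyRootWeylSum_mul_of_coprime)
S_f(h,mn) = S_f(h n̄, m) S_f(h m̄, n) for (m,n) = 1; over ℤ[∛2] the product of generators makes this
a bilinear form with cubic Kloosterman fractions e(h c²·\overline{F(b,c)}/(b²−ac)) in the
coordinates of a product — the cubic analogue of DukeFriedlanderIwaniec1997. [difficulty: XL] (why
it might fail: No Type-II for cubic root Weyl sums in print: DFI's quadratic bilinear step is a
dispersion fed by spectral Type-I at level x^(1/2) (Harman 1997: beta=1/3), absent here; a 1-D large
sieve for nu/n is open (Welsh 2018 Thm 3 is 2-D) and pure cubics may carry extra additive energy.)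
[DukeFriedlanderIwaniec1995, Harman1997, Welsh2018CubicCongruenceSpacing,
DukeFriedlanderIwaniec1997, FriedlanderIwaniecAnnals1998, FouvryIwaniec1997, arXiv:2509.00898]
#4 ShortKloostermanCubicModuli (crux) — (the engine in Kloosterman normal form; card items
D3/N2/N5(b)) for every h ≠ 0 and A > 0 there is C with Σ_{B<b,c≤2B} |Σ_{B<a≤2B, (b²−ac, b³−2c³)=1}
e(h c² \overline{(b²−ac)} / (b³−2c³))| ≤ C B³/(log B)^A for B ≥ 2, where \overline{u} u ≡ 1 (mod
b³−2c³) (rendered by Int.gcdA): ≍B² incomplete Kloosterman sums, each of length B ≍ q^{1/3} along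
the progression u = b²−ac, to the moduli q = b³−2c³ = values of the binary cubic form; by
GaussDictionaryFraction + reciprocity this is the q = 1, balanced-box model of WeylTypeI (the exact
transfer needs Welsh's fundamental domain and primitivity: Two-layer plan). Hooley's Hypothesis R*
predicts B^{5/2+ε}. [difficulty: L] (why it might fail: Length B = q^(1/3) is below completion/Weil
(q^(1/2+eps)); pointwise Karatsuba-range bounds give (log q)^-c, c fixed, prime q; so 'every A'
needs cancellation from the average over the thin moduli b^3-2c^3 (unproved); HB 2001 got power
savings only with factorable moduli.) [Hooley1978CubicPrimeFactor,
HeathBrown2001LargestPrimeFactorCubic, Irving2014LargestPrimeFactorCubic, Karatsuba1995,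
Korolev2016, DeshouillersIwaniec1982, Welsh2018CubicCongruenceSpacing]
#9 GaussDictionaryRoot (support) — (card D1, any k) for all integers k, a, b, c: N ∣ v³ − k u³ where
N = a³+kb³+k²c³−3kabc = N(a+bα+cα²), α³ = k, u = b²−ac, v = kc²−ab (the α², α coordinates of the
adjugate N/x); indeed v³ − k u³ = N·(cv − bu) (ring identity, checked by `ring` in the session
Sketch). Hence ν :≡ v·u⁻¹ is a root of X³ ≡ k (mod N) whenever (u, N) = 1 — the Dedekind–Kummer root
with x ∣ α − ν. [difficulty: provable-now] [Hooley1978CubicPrimeFactor,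
Welsh2018CubicCongruenceSpacing, Hooley1976]
#9 GaussDictionaryFraction (support) — (card D2, any k: the Kloosterman fraction) for integers
k,a,b,c,ν,t with (b³−kc³, b²−ac) = 1 and (b²−ac)ν = (kc²−ab) + N t (N as above): b²−ac ∣ t(b³−kc³) −
c², i.e. t ≡ c²·\overline{(b³−kc³)} (mod b²−ac), so ν/N = t/u + v/(uN) ≡ c²·\overline{q₀}/u +
O(|v|/(|u|N)) (mod 1) with u = b²−ac, q₀ = b³−kc³ = N(b−cα). Proof (checked in SketchProofs.lean):
c·v + q₀ = b·u and c³N − q₀² = −u(c²a²+ab²c+b⁴−3kbc³) give u ∣ q₀(q₀t − c²) with witness c³ν +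
(c²a²+ab²c+b⁴−3kbc³)t − bc², then coprimality. Simplifies Welsh 2018 Thm 1 (numerator bu−cv with
Bezout data) to a closed form. [difficulty: provable-now] [Welsh2018CubicCongruenceSpacing,
Hooley1978CubicPrimeFactor]
#9 RootWeylSumsVaughan (support) — (card N4 corrected; degree-blind) for every irreducible f ∈ ℤ[X]
of degree ≥ 2: Type-I (as in WeylTypeI, for f) and Type-II (as in WeylTypeII, for f) imply Σ_{p≤P}
S_f(h,p) = o(P/log P) for every h ≠ 0. Proof: Vaughan's identity (tree:
Literature.NumberTheory.Sieve.vaughan_identity_add_holds) with U = V = x^{η/2} for Σ_{n≤x}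
Λ(n)S_f(h,n); Type-I pieces by partial summation (coefficients ≤ log x), Type-II pieces after dyadic
decomposition and Perron separation of mn ≤ x (twists m^{it} absorbed in α, β); ℓ² norms by Σ_{n≤x}
ρ_f(n)² ≪ x(log x)^c (tree: PolynomialCongruencesMeanValues); prime powers O(√x); partial summation
removes log p (IwaniecKowalski2004 §13.4). [difficulty: XL] [Vaughan1977, IwaniecKowalski2004,
Harman2007, DukeFriedlanderIwaniec1995]

TWO-LAYER PLAN. Foreseen glued splits (k ≤ 3, depth 1; nothing filed now). WeylTypeI ⇐
KloostermanProgressions (ShortKloostermanCubicModuli with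
a ≡ a₀ (mod q) resp. x ∈ 𝔮 for the ρ(q) primitive ideals of norm q, and (a,b,c) in sectors of
Welsh's fundamental domain
N^{1/3}/(2ε) ≤ x^{(1)} < N^{1/3}/2 instead of a box) → DictionaryTransfer (primitive ideals of ℤ[∛2]
↔ roots, Welsh 2018 Lemmas
1–2; primitivity gcd(a²−2bc, 2c²−ab, b²−ac) = 1 by Möbius over ideal divisors; the error e(hv/(uN))
= 1 + O(h/N); fibres with
(u, N) > 1 or |u| small handled by the other two Welsh approximants) → WeylTypeI. WeylTypeII ⇐
PureCubicRootLargeSieve (1-D: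
Σ_{n~N}Σ_{ν³≡2 (n)}|Σ_{k≤K} a_k e(kν/n)|² ≤ C_ε(N+K)(NK)^ε‖a‖², card cubic-roots-large-sieve C1) →
BilinearKloostermanCbrt2 (a
DFI-1997-type estimate for Σ_y Σ_z α_y β_z e(hν_{yz}/N(yz)) over ℤ[∛2], or a dispersion in which the
m-sums are twisted Hooley
sums S_{n³X³−2}(h,m) in progressions) → WeylTypeII. ShortKloostermanCubicModuli ⇐ (pointwise
Karatsuba range for prime
b³−2c³) + (mean value over the family) if a prover wants it.

KILL CRITERIA. ShortKloostermanCubicModuli refuted (Ω(B³(log B)^{-A₀}) for some A₀ along a sequence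
of B, or kit numerics at B ≤ 2¹² showing
S/B³ not decaying) kills the engine of the whole line: close `refuted:ShortKloostermanCubicModuli`
unless WeylTypeI has meanwhile
acquired another engine. WeylTypeII refuted by a structured pair (α, β) ⇒ pivot once: restate
Type-II for the coefficient classes
Vaughan actually produces (β = (μ_{>V}∗1), α = Λ on dyadic ranges) — if that also dies, close.
WeylTypeI refuted ⇒ close (the
target would then need level-free methods, i.e. route CubicRoots' dynamics). RootsModPrimesCbrtTwo
refuted ⇒ ¬stmt-Parity-0878:
file it, CubicRoots goes BROKEN, close here. stmt-Parity-0878 (all cubics) proved elsewhere ⇒ close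
`superseded`.

NOT DECOMPOSED YET. (i) The dictionary transfer WeylTypeI ⇐ Kloosterman mean values in ideal
progressions (fundamental domain for the unit
1+∛2+∛4, primitivity, the three Welsh approximants, error terms) — layer-2 glue, see Two-layer plan.
(ii) The Type-II engine
(1-D large sieve LSR₃ for pure-cubic root fractions + bilinear Kloosterman fractions over ℤ[∛2]).
(iii) Power savings: r4 =
CubicRoots.CubicHooleyPowerSaving for X³−2 is NOT claimed — Heath-Brown's unconditional saving needs
factorable moduli KL with
N(K) ∈ (X^{3δ}, X^{4δ}] (Irving 2014 Lemmas 2.2–2.3) and the primary source is paywalled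
(acq-02428); a `cite` fact request is
filed instead; Hooley's Hypothesis R* ⇒ r4 is a possible CONDITIONAL bridge once Hooley 1978
(acq-02433) is held. (iv) Other
pure cubics X³−k (class number of ℤ[∛k], non-maximal orders: per-class dictionaries) and general
S₃-cubics (only
GaussDictionaryRoot survives; N mod u does not collapse). (v) The parity side (CubicRoots r2,
CubicMobiusTail) is untouched
by design: in the dictionary r2 is μ_K on the cone against the shrinking target {c²q̄₀/u} < x/N,
recorded for the tenure planner only.

CHEAPEST FALSIFIER. Numerics of ShortKloostermanCubicModuli (card N5(b)). RUN in this session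
(python, folder/kmv_test.py, h ∈ {1,3}, k = 2,
B ∈ {48, 64, 96, 128, 192, 256}): rms |Σ_a|/√(#a) = 1.00 ± 0.02 at every B; S/trivial = 0.149,
0.131, 0.105, 0.091, 0.074,
0.064 ∝ B^{-1/2} (square-root cancellation, Hooley-R* behaviour); max_{(b,c)} |Σ_a|/√(#a) ≤ 3.4 over
65 536 moduli; no (b,c) with
|Σ_a| > B/2. So the engine statement passes its cheapest test; the next cheapest is the same
statistic restricted to a ≡ a₀ (mod q),
q ≤ B^{1/2} (the progression version WeylTypeI needs), and kit at B = 2¹⁰–2¹² with k ∈ {2,3}; for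
WeylTypeII: the correlations
Σ_{m≤M} S_f(h, mn) conj S_f(h, mn′) for n ≠ n′ ≤ M^{1/2} (should be O(√M)).

NUMBERS. Hooley's exponent δ₃ = (3−√3)/6 ≈ 0.2113 (tree `hooleyDelta`; the only Type-I saving in
print, q = 1). DFI 1995 in Harman's
normalisation: α = ε, β = 1/3 − 2ε, Type-I level x^{1/2−ε} (Harman1997 p.171 item 7). Heath-Brown
2001: P⁺(n³+2) > X^{1+ϖ},
ϖ = 10^{-303} (Irving 2014: 10^{-52}; δ = 1/321; factorable moduli N(K) ∈ (X^{3δ}, X^{4δ}], N(KL) ∈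
(X^{1+δ}, X^{1+2δ}]);
asymptotics for #{n ≤ X : d ∣ n³+2} only for d ≤ X (Irving p.3). Welsh 2018: approximant
denominators ≍ m^{2/3}, error O(1/m),
2-D large sieve (M+K)(M+L)‖a‖² (trivial for KL ≤ M); fundamental unit ε = 1+∛2+∛4 ≈ 3.847;
fundamental domain
N^{1/3}/(2ε) ≤ x^{(1)} < N^{1/3}/2 gives a, b, c ≪ N^{1/3} and a²−2bc, 2c²−ab, b²−ac ≍ N^{2/3}.
Kloosterman length/modulus
exponent 1/3 (below Weil's 1/2). Session numerics: S/trivial ≈ 1.03·B^{-1/2} for B ≤ 256. Items at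
open: 8 (1 target, 3 cruxes,
3 supports, 1 assembly).

DEFINITION REQUESTS. None for the statements (all over
`Literature.NumberTheory.Sieve.polyRootWeylSum`, Mathlib `Int.gcdA`, `Nat.primesLE`). Fact (cite)
requests filed after open: (1) Heath-Brown 2001 PLMS 82 Thms 1–2 (level of distribution of n³+2
beyond X for factorable moduli;
q-analogue of van der Corput for short Kloosterman sums) — pending acq-02428; (2) Welsh 2018 Thm 3
(2-D large sieve for the roots
of X³ ≡ 2) and Thm 1 (approximation), held (arXiv:1809.05211), vendorable now for Type-II provers;
(3) Hooley's Hypothesis R*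
(Hooley 1978) as a named open hypothesis — pending acq-02433.

Novelty: Searches (2026-08-15): `ledger idea list --problem Parity --sub BatemanHorn` (all cards; companions
cubic-roots-large-sieve,
cubic-roots-one-unknown-per-prime, smooth-cubic-below-square [retired: known HB2001]); route files
CubicRoots/PolynomialMobius/
UnimodularColumns/SelbergDelange/MinorArcs/AsymptoticSieve read; `ledger negatives --problem Parity`
(0); `lit frontier Parity
--since 2020` (30 rows, none on cubic congruence roots); `lit bridges Parity --cross any` (generic);
`lit search --source zbmath`
'Duke Friedlander Iwaniec roots quadratic congruence' (Zbl 0840.11003) and 'Karatsuba incomplete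
Kloosterman sums short' (7 rows:
Karatsuba 1995/1997, Korolev 2016 ×2, 2022 ×2, Semenova 2022, Bourgain 2005); `lit galaxy search
--star all "roots of a quadratic
congruence to prime moduli"` (12 rows: FHI LNM 1891, Harman LMS-33, Greaves–Harman–Huxley, Kowalski
probabilistic NT — books only)
and `--star pdf "Roots of quadratic congruences"` (2, irrelevant); `lit read` arXiv:1809.05211
(Welsh 2018, all 13 pp.),
arXiv:1412.0024 pp.3–4 (Irving), book:hooley1987 p.40 (tract, X=x²−2yz, Y=y²−zx, Z=2z²−xy,
'incomplete Kloosterman sums … too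
short … conditional'), Greaves–Harman–Huxley p.171 (Harman on DFI), FI98 Lemma 3.2 tree file; `lit
read doi:10.1112/plms/82.3.554`
and `doi:10.1515/crll.1978.303-304.21` → paywalled (acq-02428, acq-02433); lean search:
polyRootWeylSum, polyRootWeylSum_mul_of_coprime,
hooley_polyRoots_logPowerSaving_holds, vaughan_identity_add_holds, largeSieve_quadra  [refs: 10.1112/plms/82.3.554`, 10.1515/crll.1978.303-304.21`, 10.1515/crll.1978.303-304.21, 10.1112/plms/82.3.554, 10.2307/2118527, 1809.05211, 1412.0024, book:hooley1987, doi:10.1112/plms/82.3.554, doi:10.1515/crll.1978.303-304.21, doi:10.2307/2118527, DukeFriedlanderIwaniec1995, Toth2000, KowalskiSoundararajan2021]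

Barriers (technique_class: kloosterman-sums cubic-roots type-I/II norm-forms): - technique_class: kloosterman-sums cubic-roots type-I/II norm-forms
- Literature.Barriers.Parity.FordMaynardLowLevel: not engaged — the prime-detecting identity runs
over the MODULI p of a dense sequence a_n = S_f(h,n) (not over the thin value set n³+2), with
Type-II assumed on the whole range [x^δ, x^{1−δ}] (crux WeylTypeII) and Type-I only at level x^η;
Vaughan then needs no Type-I level beyond UV = x^η, consistent with Ford–Maynard's thresholds, which
concern what Type-I/II information forces primes, not cancellation of a signed sum.
- Literature.Barriers.Parity.FordMaynardMinimalTypeII: names exactly why WeylTypeII is filed as a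
crux and not presumed: some Type-II information is indispensable; the route assumes the full
bilinear range and bets on the Kloosterman-fraction structure over ℤ[∛2] to supply it.
- Literature.Barriers.Parity.SelbergParityBarrier: not engaged — the deliverable is cancellation in
Σ_p S_f(h,p) (root equidistribution), parity-free input to CubicRoots; the parity content of cubic
Bateman–Horn (r2, CubicMobiusTail) is untouched and said so (Not decomposed yet (v)).
- Literature.Barriers.Parity.FordFixedLevelBarrier: not engaged — no Λ-asymptotic for polynomial
values is drawn from fixed-level Type-I data; the only sieve identity is Vaughan's for the modulus
variable with Type-II present.
- Literature.Barriers.Parity.LargeSieveLevelHalf: not engaged — no level of distribution past 1/2 is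
claimed anywhere (Type-I level is N^η; the large sieve foreseen i

Novelty grade: new-combination — ROUTE-REVIEW grade (refuter 2c4772d4, 2026-08-15): new-combination = [Hooley 1978 norm-form/Kloosterman dictionary for ν³≡2 (doi:10.1515/crll.1978.303-304.21; re-derived Welsh 2018 arXiv:1809.05211 Thm 1; used by Heath-Brown 2001 doi:10.1112/plms/82.3.554 and Irving 2014 arXiv:1412.0024 for P⁺(n³+2) (refuter refuter-rreview-route-HubbardSuperconduc-2c4772d4-0, 2026-08-15T13:52:58Z; prior: doi:10.1515/crll.1978.303-304.21, arXiv:1809.05211, doi:10.1112/plms/82.3.554, arXiv:1412.0024, doi:10.2307/2118527, Vaughan1977, route-Parity-CubicRoots)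

History (route lifecycle, newest last):
- 2026-08-15T13:49:32Z · CLOSED retired — not-a-thesis: assembly does not conclude the sub-problem Statement (operator:999:1257524)

sub-problem: BatemanHorn · status: closed(retired) · opened planner-plancard-Parity-BatemanHorn-cubic-klo-0581dd2e-0 2026-08-15T12:32:02Z · rev 0 · ledger route-Parity-CubicKloosterman
GENERATED by the gate from the ledger (D-0016/17). Provers cite these decls: `theorem foo : Summit.Parity.BatemanHorn.Theses.CubicKloosterman.<Decl> := …` in Summits/Parity/BatemanHorn/Theorems/<Name>.lean.
-/

namespace Summit.Parity.BatemanHorn.Theses.CubicKloosterman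

open scoped BigOperators Topology Manifold Classical MeasureTheory ProbabilityTheory Matrix InnerProductSpace ComplexConjugate ContinuousMap
open Filter Set Function TopologicalSpace MeasureTheory

attribute [summit_statement] _root_.BatemanHorn

/-- item stmt-Parity-8165 · target · rank 0 · closed · moot by None · by planner
why it might fail: open since DFI 1995 (degree 2 only: Literature.NumberTheory.Sieve.dukeFriedlanderIwaniecToth_quadraticRoots_primeModuli); false only if the roots of X³≡2 are biased mod p, against Chebotarev/Hecke expectations; refuter numerics on 0878 to P = 10⁶ show square-root cancellation.
sources: KowalskiSoundararajan2021, DukeFriedlanderIwaniec1995, Toth2000, Welsh2018CubicCongruenceSpacing, Welsh2022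
[target] for every integer h ≠ 0, Σ_{p ≤ P} Σ_{ν mod p, ν³ ≡ 2} e(hν/p) = o(P/log P) (p prime) — the
f = X³−2 instance of CubicRoots.CubicRootsPrimeModuli (stmt-Parity-0878: natDegree (X³−C 2) = 3,
Eisenstein at 2), i.e. Kowalski–Soundararajan Conj. A.2 for X³−2 in Weyl form; Σ_{p≤P} ρ(p) ~ P/log
P by the prime ideal theorem for ℚ(∛2). -/
@[route_item "route-Parity-CubicKloosterman"]
def RootsModPrimesCbrtTwo : Prop :=
  ∀ h : ℤ, h ≠ 0 → (fun P : ℕ => ∑ p ∈ Nat.primesLE P, ∑ ν ∈ (Finset.range p).filter (fun ν : ℕ => (p : ℤ) ∣ (Polynomial.X ^ 3 - Polynomial.C 2 : Polynomial ℤ).eval (ν : ℤ)), Complex.exp (2 * Real.pi * Complex.I * (h * ν / p : ℂ))) =o[Filter.atTop] fun P : ℕ => ((P : ℝ) / Real.log P : ℝ)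

/-- item stmt-Parity-8166 · crux · rank 2 · closed · moot by None · by planner
why it might fail: Print has only (log N)^-0.21 at q=1 (Hooley 1964). Each (b,c)-fibre is a Kloosterman sum of length q0^(1/3): pointwise Karatsuba/Korolev bounds save a fixed small log-power (prime q0), so every A must come from averaging over the thin moduli b^3-2c^3, for which no mean-value theory exists.
sources: Hooley1964, Hooley1978CubicPrimeFactor, HeathBrown2001LargestPrimeFactorCubic, Karatsuba1995, Korolev2016, arXiv:1211.4184
[crux] (card item N2, Weyl-sum form) for every h ≠ 0 and A > 0 there are η > 0 and C with Σ_{q ≤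
N^η} max_{y ≤ N} |Σ_{n ≤ y, q ∣ n} S_f(h,n)| ≤ C N/(log N)^A for all N ≥ 2, f = X³−2, S_f =
polyRootWeylSum (the max is rendered by an arbitrary cutoff function y(q) ≤ N). Level N^η only; any
A. q = 1 is Hooley 1964 with A = δ₃ = (3−√3)/6 ≈ 0.21 (PROVED in the tree:
hooley_polyRoots_logPowerSaving_holds); every A > 0.22 is new. [difficulty: XL] -/
@[route_item "route-Parity-CubicKloosterman"]
def WeylTypeI : Prop :=
  ∀ h : ℤ, h ≠ 0 → ∀ A : ℝ, 0 < A → ∃ η : ℝ, 0 < η ∧ ∃ C : ℝ, ∀ N : ℕ, 2 ≤ N → ∀ y : ℕ → ℕ, (∀ q, y q ≤ N) → ∑ q ∈ Finset.Icc 1 ⌊(N : ℝ) ^ η⌋₊, ‖∑ n ∈ (Finset.Icc 1 (y q)).filter (fun n : ℕ => q ∣ n), ∑ ν ∈ (Finset.range n).filter (fun ν : ℕ => (n : ℤ) ∣ (Polynomial.X ^ 3 - Polynomial.C 2 : Polynomial ℤ).eval (ν : ℤ)), Complex.exp (2 * Real.pi * Complex.I * (h * ν / n : ℂ))‖ ≤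 C * (N : ℝ) / Real.log N ^ A

/-- item stmt-Parity-8167 · crux · rank 3 · closed · moot by None · by planner
why it might fail: No Type-II for cubic root Weyl sums in print: DFI's quadratic bilinear step is a dispersion fed by spectral Type-I at level x^(1/2) (Harman 1997: beta=1/3), absent here; a 1-D large sieve for nu/n is open (Welsh 2018 Thm 3 is 2-D) and pure cubics may carry extra additive energy.
sources: DukeFriedlanderIwaniec1995, Harman1997, Welsh2018CubicCongruenceSpacing, DukeFriedlanderIwaniec1997, FriedlanderIwaniecAnnals1998, FouvryIwaniec1997
[crux] for every h ≠ 0, δ > 0, A > 0 there is C such that for x ≥ 2, M, N ≥ x^δ with MN ≤ x and all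
complex α, β: |Σ_{M<m≤2M} Σ_{N<n≤2N} α_m β_n S_f(h, mn)| ≤ C ‖α‖₂ ‖β‖₂ (MN)^{1/2} (log x)^{-A} (f =
X³−2). By twisted multiplicativity (tree: polyRootWeylSum_mul_of_coprime) S_f(h,mn) = S_f(h n̄, m)
S_f(h m̄, n) for (m,n) = 1; over ℤ[∛2] the product of generators makes this a bilinear form with
cubic Kloosterman fractions e(h c²·\overline{F(b,c)}/(b²−ac)) in the coordinates of a product — the
cubic analogue of DukeFriedlanderIwaniec1997. [difficulty: XL] -/
@[route_item "route-Parity-CubicKloosterman"]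
def WeylTypeII : Prop :=
  ∀ h : ℤ, h ≠ 0 → ∀ δ : ℝ, 0 < δ → ∀ A : ℝ, 0 < A → ∃ C : ℝ, ∀ x M N : ℕ, 2 ≤ x → (x : ℝ) ^ δ ≤ M → (x : ℝ) ^ δ ≤ N → (M : ℝ) * N ≤ x → ∀ α β : ℕ → ℂ, ‖∑ m ∈ Finset.Ioc M (2 * M), ∑ n ∈ Finset.Ioc N (2 * N), α m * β n * ∑ ν ∈ (Finset.range (m * n)).filter (fun ν : ℕ => ((m * n : ℕ) : ℤ) ∣ (Polynomial.X ^ 3 - Polynomial.C 2 : Polynomial ℤ).eval (ν : ℤ)), Complex.exp (2 * Real.pi * Complex.I * (h * ν / ((m * n : ℕ) : ℂ) : ℂ))‖ ≤ C * Real.sqrt (∑ m ∈ Finset.Ioc M (2 * M), ‖α m‖ ^ 2) * Real.sqrt (∑ n ∈ Finset.Ioc N (2 * N), ‖β n‖ ^ 2) * Real.sqrt ((M : ℝ) * N) / Real.log x ^ A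

/-- item stmt-Parity-8168 · crux · rank 4 · closed · moot by None · by planner
why it might fail: Length B = q^(1/3) is below completion/Weil (q^(1/2+eps)); pointwise Karatsuba-range bounds give (log q)^-c, c fixed, prime q; so 'every A' needs cancellation from the average over the thin moduli b^3-2c^3 (unproved); HB 2001 got power savings only with factorable moduli.
sources: Hooley1978CubicPrimeFactor, HeathBrown2001LargestPrimeFactorCubic, Irving2014LargestPrimeFactorCubic, Karatsuba1995, Korolev2016, DeshouillersIwaniec1982
[crux] (the engine in Kloosterman normal form; card items D3/N2/N5(b)) for every h ≠ 0 and A > 0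
there is C with Σ_{B<b,c≤2B} |Σ_{B<a≤2B, (b²−ac, b³−2c³)=1} e(h c² \overline{(b²−ac)} / (b³−2c³))| ≤
C B³/(log B)^A for B ≥ 2, where \overline{u} u ≡ 1 (mod b³−2c³) (rendered by Int.gcdA): ≍B²
incomplete Kloosterman sums, each of length B ≍ q^{1/3} along the progression u = b²−ac, to the
moduli q = b³−2c³ = values of the binary cubic form; by GaussDictionaryFraction + reciprocity this
is the q = 1, balanced-box model of WeylTypeI (the exact transfer needs Welsh's fundamental domain
and primitivity: Two-layer plan). Hooley's Hypothesis R* predicts B^{5/2+ε}. [difficulty: L] -/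
@[route_item "route-Parity-CubicKloosterman"]
def ShortKloostermanCubicModuli : Prop :=
  ∀ h : ℤ, h ≠ 0 → ∀ A : ℝ, 0 < A → ∃ C : ℝ, ∀ B : ℕ, 2 ≤ B → ∑ b ∈ Finset.Ioc B (2 * B), ∑ c ∈ Finset.Ioc B (2 * B), ‖∑ a ∈ (Finset.Ioc B (2 * B)).filter (fun a : ℕ => Int.gcd ((b : ℤ) ^ 2 - a * c) ((b : ℤ) ^ 3 - 2 * c ^ 3) = 1), Complex.exp (2 * Real.pi * Complex.I * (((h * (c : ℤ) ^ 2 * Int.gcdA ((b : ℤ) ^ 2 - a * c) ((b : ℤ) ^ 3 - 2 * c ^ 3) : ℤ) : ℂ) / (((b : ℤ) ^ 3 - 2 * c ^ 3 : ℤ) : ℂ)))‖ ≤ C * (B : ℝ) ^ 3 / Real.log B ^ A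

/-- item stmt-Parity-8169 · support · rank 9 · closed · moot by None · by planner
sources: Hooley1978CubicPrimeFactor, Welsh2018CubicCongruenceSpacing, Hooley1976
[support] (card D1, any k) for all integers k, a, b, c: N ∣ v³ − k u³ where N = a³+kb³+k²c³−3kabc =
N(a+bα+cα²), α³ = k, u = b²−ac, v = kc²−ab (the α², α coordinates of the adjugate N/x); indeed v³ −
k u³ = N·(cv − bu) (ring identity, checked by `ring` in the session Sketch). Hence ν :≡ v·u⁻¹ is a
root of X³ ≡ k (mod N) whenever (u, N) = 1 — the Dedekind–Kummer root with x ∣ α − ν. [difficulty: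
provable-now] -/
@[route_item "route-Parity-CubicKloosterman"]
def GaussDictionaryRoot : Prop :=
  ∀ k a b c : ℤ, a ^ 3 + k * b ^ 3 + k ^ 2 * c ^ 3 - 3 * k * a * b * c ∣ (k * c ^ 2 - a * b) ^ 3 - k * (b ^ 2 - a * c) ^ 3

/-- item stmt-Parity-8170 · support · rank 9 · closed · moot by None · by planner
sources: Welsh2018CubicCongruenceSpacing, Hooley1978CubicPrimeFactor
[support] (card D2, any k: the Kloosterman fraction) for integers k,a,b,c,ν,t with (b³−kc³, b²−ac) =
1 and (b²−ac)ν = (kc²−ab) + N t (N as above): b²−ac ∣ t(b³−kc³) − c², i.e. t ≡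
c²·\overline{(b³−kc³)} (mod b²−ac), so ν/N = t/u + v/(uN) ≡ c²·\overline{q₀}/u + O(|v|/(|u|N)) (mod
1) with u = b²−ac, q₀ = b³−kc³ = N(b−cα). Proof (checked in SketchProofs.lean): c·v + q₀ = b·u and
c³N − q₀² = −u(c²a²+ab²c+b⁴−3kbc³) give u ∣ q₀(q₀t − c²) with witness c³ν + (c²a²+ab²c+b⁴−3kbc³)t −
bc², then coprimality. Simplifies Welsh 2018 Thm 1 (numerator bu−cv with Bezout data) to a closed
form. [difficulty: provable-now] -/
@[route_item "route-Parity-CubicKloosterman"]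
def GaussDictionaryFraction : Prop :=
  ∀ k a b c ν t : ℤ, IsCoprime (b ^ 3 - k * c ^ 3) (b ^ 2 - a * c) → (b ^ 2 - a * c) * ν = (k * c ^ 2 - a * b) + (a ^ 3 + k * b ^ 3 + k ^ 2 * c ^ 3 - 3 * k * a * b * c) * t → b ^ 2 - a * c ∣ t * (b ^ 3 - k * c ^ 3) - c ^ 2

/-- item stmt-Parity-8171 · support · rank 9 · closed · moot by None · by planner
sources: Vaughan1977, IwaniecKowalski2004, Harman2007, DukeFriedlanderIwaniec1995
[support] (card N4 corrected; degree-blind) for every irreducible f ∈ ℤ[X] of degree ≥ 2: Type-I (as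
in WeylTypeI, for f) and Type-II (as in WeylTypeII, for f) imply Σ_{p≤P} S_f(h,p) = o(P/log P) for
every h ≠ 0. Proof: Vaughan's identity (tree:
Literature.NumberTheory.Sieve.vaughan_identity_add_holds) with U = V = x^{η/2} for Σ_{n≤x}
Λ(n)S_f(h,n); Type-I pieces by partial summation (coefficients ≤ log x), Type-II pieces after dyadic
decomposition and Perron separation of mn ≤ x (twists m^{it} absorbed in α, β); ℓ² norms by Σ_{n≤x}
ρ_f(n)² ≪ x(log x)^c (tree: PolynomialCongruencesMeanValues); prime powers O(√x); partial summation
removes log p (IwaniecKowalski2004 §13.4). [difficulty: XL] -/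
@[route_item "route-Parity-CubicKloosterman"]
def RootWeylSumsVaughan : Prop :=
  ∀ f : Polynomial ℤ, 2 ≤ f.natDegree → Irreducible f → (∀ h : ℤ, h ≠ 0 → ∀ A : ℝ, 0 < A → ∃ η : ℝ, 0 < η ∧ ∃ C : ℝ, ∀ N : ℕ, 2 ≤ N → ∀ y : ℕ → ℕ, (∀ q, y q ≤ N) → ∑ q ∈ Finset.Icc 1 ⌊(N : ℝ) ^ η⌋₊, ‖∑ n ∈ (Finset.Icc 1 (y q)).filter (fun n : ℕ => q ∣ n), ∑ ν ∈ (Finset.range n).filter (fun ν : ℕ => (n : ℤ) ∣ f.eval (ν : ℤ)), Complex.exp (2 * Real.pi * Complex.I * (h * ν / n : ℂ))‖ ≤ C * (N : ℝ) / Real.log N ^ A) → (∀ h : ℤ, h ≠ 0 → ∀ δ : ℝ, 0 < δ → ∀ A : ℝ, 0 < A → ∃ C : ℝ, ∀ x M N : ℕ, 2 ≤ x → (x : ℝ) ^ δ ≤ M → (x : ℝ) ^ δ ≤ N → (M : ℝ) * N ≤ x → ∀ α β : ℕ → ℂ, ‖∑ m ∈ Finset.Ioc M (2 * M), ∑ n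 ∈ Finset.Ioc N (2 * N), α m * β n * ∑ ν ∈ (Finset.range (m * n)).filter (fun ν : ℕ => ((m * n : ℕ) : ℤ) ∣ f.eval (ν : ℤ)), Complex.exp (2 * Real.pi * Complex.I * (h * ν / ((m * n : ℕ) : ℂ) : ℂ))‖ ≤ C * Real.sqrt (∑ m ∈ Finset.Ioc M (2 * M), ‖α m‖ ^ 2) * Real.sqrt (∑ n ∈ Finset.Ioc N (2 * N), ‖β n‖ ^ 2) * Real.sqrt ((M : ℝ) * N) / Real.log x ^ A) → ∀ h : ℤ, h ≠ 0 → (fun P : ℕ => ∑ p ∈ Nat.primesLE P, ∑ ν ∈ (Finset.range p).filter (fun ν : ℕ => (p : ℤ) ∣ f.eval (ν : ℤ)), Complex.exp (2 * Real.pi * Complex.I * (h * ν / p : ℂ))) =o[Filter.atTop] fun P : ℕ => ((P : ℝ) / Real.log P : ℝ)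

/-- item stmt-Parity-8172 · assembly · rank 1 · closed · moot by None · by planner
sources: Vaughan1977, DukeFriedlanderIwaniec1995
[assembly] WeylTypeI → WeylTypeII → RootWeylSumsVaughan → RootsModPrimesCbrtTwo (specialise the
support to f = X³ − 2). -/
@[route_item "route-Parity-CubicKloosterman"]
def Assembly : Prop :=
  WeylTypeI → WeylTypeII → RootWeylSumsVaughan → RootsModPrimesCbrtTwo

end Summit.Parity.BatemanHorn.Theses.CubicKloosterman
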